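import Literature.Barriers.PneNP.TSPExtensionComplexityFarkas
import Mathlib.Algebra.Order.BigOperators.Group.Finset
import HarnessLib

/-!
MAINTENANCE 2026-08-20 (ops-buildfix lane): `hyperplane_separation_bound` is now `hyperplane_separation_bound'` in this file — the unprimed fully-qualified name is ALSO
declared (a different variant of the same cited statement) in `TSPExtensionComplexityFactorization.lean`, and two modules declaring one name cannot be
co-imported (this broke the `Literature` root aggregate). Only the name changed; statement and proof are byte-identical.

# Yannakakis' factorization theorem (lower-bound direction) and the hyperplane separation bound

Support file for the Rothvoß bound `Literature.Barriers.PneNP.Rothvoss2017_tsp` (companion of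
`TSPExtensionComplexityFarkas.lean`, which supplies LP duality for slack-form systems,
`ExtendedFormulation.exists_multipliers`). Rothvoß's lower bound for the matching and TSP
polytopes goes through the **hyperplane separation bound** on the NONNEGATIVE RANK of the slack
matrix (Rothvoß 2017, Lemma 5), which — unlike the rectangle-covering bound used for FMPTW
Thm. 12 in `…Rectangles.lean` — needs the genuine nonnegative FACTORIZATION of the slack matrix
given by Yannakakis' theorem (Rothvoß 2017, Thm. 4, direction `rk₊(S) ≤ xc(P) (+1)`; FMPTW
Thm. 3). This file proves, sorry-free and fact-free:

* `HasEFOfSize.exists_nonneg_factorization` — **Yannakakis' factorization theorem (lower-bound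
  direction)** in the `HasEFOfSize` currency: an EF of size `r` of `P` yields, for any points
  `v_b ∈ P` and valid inequalities `c_a · x ≤ d_a`, nonnegative vectors `U_a, T_b ∈ ℝ^{r+1}`
  (indexed by `Option (Fin r)`) with `d_a - c_a · v_b = ⟨U_a, T_b⟩`;
* `sum_mul_mul_le_of_rectangles` — fractional rectangles are no better than `0/1` rectangles;
  `hyperplane_separation_bound'` — **Rothvoß's Lemma 5** in finite form: for `S = Σ_i U(i)T(i)ᵀ`
  (`|I|` nonnegative rank-one terms, entries `≤ s`) and any weights `W` with `W(X × Y) ≤ α` on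
  every rectangle avoiding the zeros of `S`, `⟨W, S⟩ ≤ α s |I|`;
* `HasEFOfSize.weight_slack_le` — the two combined: `⟨W, S⟩ ≤ α s (r + 1)` for the slack matrix
  of any points/valid inequalities of a set with an EF of size `r`. With Rothvoß's weights on
  odd cuts × perfect matchings (`⟨W,S⟩ = 1`, `s ≤ n`, `α ≤ 2^{-δn}`: his Lemma 6) this is the
  inequality `r + 1 ≥ 2^{δn}/n`.

## Sources

* [Rothvoss2017] T. Rothvoß, *The matching polytope has exponential extension complexity*,
  J. ACM 64 (2017) = arXiv:1311.2369 (held): Thm. 4 and its proof (PDF p. 5), Lemma 5 and its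
  proof (PDF p. 6: "conv{R ∈ [0,1]^{f×v} : rank(R) ≤ 1} = conv{R ∈ {0,1}^{f×v} : rank(R) ≤ 1}";
  "⟨W,S⟩ = Σ ‖R_i‖_∞ ⟨W, R_i/‖R_i‖_∞⟩ ≤ α r ‖S‖_∞").
* [FioriniEtAl2015] arXiv:1111.0837: Thm. 3 (PDF p. 8) — held.
-/

noncomputable section

namespace Literature.Barriers.PneNP

open Matrix Finset

/-! ### Yannakakis' factorization from LP duality -/

section Factorization

variable {ι : Type} [Fintype ι] {r : ℕ}

/-- **Yannakakis' factorization theorem, lower-bound direction** (the half of `xc(P) = rk₊(S)`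
used for lower bounds): if `P` has an extended formulation of size `r`, then for any points
`v_b ∈ P` and any inequalities `c_a · x ≤ d_a` valid on `P`, the slack matrix
`S(a,b) = d_a - c_a · v_b` has a nonnegative factorization through `r + 1` coordinates
(`Option (Fin r)`: the `r` slack variables of the lifts, plus one coordinate for the constant
`d_a - λ_aᵀg ≥ 0`). [cite: Rothvoss2017, Thm. 4 (PDF p. 5)] -/
theorem HasEFOfSize.exists_nonneg_factorization {P : Set (ι → ℝ)} (h : HasEFOfSize P r)
    {A B : Type*} (v : B → ι → ℝ) (hv : ∀ b, v b ∈ P) (c : A → ι → ℝ) (d : A → ℝ)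
    (hvalid : ∀ a, ∀ x ∈ P, c a ⬝ᵥ x ≤ d a) :
    ∃ (U : A → Option (Fin r) → ℝ) (T : B → Option (Fin r) → ℝ),
      (∀ a i, 0 ≤ U a i) ∧ (∀ b i, 0 ≤ T b i) ∧
        ∀ a b, d a - c a ⬝ᵥ v b = ∑ i, U a i * T b i := by
  classical
  obtain ⟨Q, hQ⟩ := h
  subst hQ
  rcases isEmpty_or_nonempty B with hB | hB
  · exact ⟨fun _ _ => 0, fun _ _ => 0, fun _ _ => le_rfl, fun _ _ => le_rfl,
      fun _ b => (IsEmpty.false b).elim⟩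
  obtain ⟨b₀⟩ := hB
  have hne : Q.projSet.Nonempty := ⟨v b₀, hv b₀⟩
  -- multipliers for each valid inequality, lifts for each point
  choose lam hlamE hlamF hlamg using fun a => Q.exists_multipliers hne (hvalid a)
  choose y hy hsys using hv
  refine ⟨fun a => Option.elim' (d a - lam a ⬝ᵥ Q.g) (fun j => vecMul (lam a) Q.F j),
    fun b => Option.elim' 1 (fun j => y b j), ?_, ?_, ?_⟩
  · intro a i
    cases i with
    | none => simpa using hlamg a
    | some j => simpa using hlamF a j
  · intro b i
    cases i with
    | none => simp
    | some j => simpa using hy b j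
  · intro a b
    rw [Fintype.sum_option]
    simp only [Option.elim', mul_one]
    have h1 : c a ⬝ᵥ v b = lam a ⬝ᵥ (Q.E *ᵥ v b) := by
      rw [dotProduct_mulVec, hlamE]
    have h2 : Q.E *ᵥ v b = Q.g - Q.F *ᵥ y b := by
      rw [← hsys b]; abel
    rw [h1, h2, dotProduct_sub, dotProduct_mulVec]
    simp only [dotProduct]
    ring

end Factorization


/-! ### The hyperplane separation lower bound (Rothvoß 2017, Lemma 5) -/

section Hyperplane

variable {A B : Type*} [Fintype A] [Fintype B]

/-- Rounding one side of a fractional rectangle: for `0 ≤ x ≤ 1`,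
`Σ_a x_a g_a ≤ Σ_{a : x_a > 0, g_a > 0} g_a`. [folklore] -/
theorem sum_mul_le_sum_filter_pos [DecidableEq A] (x g : A → ℝ) (hx : ∀ a, 0 ≤ x a ∧ x a ≤ 1) :
    ∑ a, x a * g a ≤ ∑ a ∈ univ.filter (fun a => 0 < x a ∧ 0 < g a), g a := by
  rw [Finset.sum_filter]
  refine Finset.sum_le_sum fun a _ => ?_
  obtain ⟨h0, h1⟩ := hx a
  by_cases hxa : 0 < x a
  · by_cases hga : 0 < g a
    · rw [if_pos ⟨hxa, hga⟩]
      nlinarith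
    · rw [if_neg fun h => hga h.2]
      push Not at hga
      nlinarith
  · have : x a = 0 := le_antisymm (not_lt.1 hxa) h0
    rw [this, zero_mul]
    split_ifs with h
    · exact h.2.le
    · exact le_rfl

/-- **Fractional rectangles are no better than rectangles** ("conv{R ∈ [0,1]^{f×v} : rank R ≤ 1}
= conv{R ∈ {0,1}^{f×v} : rank R ≤ 1}"): if every `0/1` rectangle `X × Y` inside the support of
`x yᵀ` has `W`-weight at most `α`, then so does `x yᵀ` for `x ∈ [0,1]^A`, `y ∈ [0,1]^B`.
[cite: Rothvoss2017, Lemma 5 (proof, PDF p. 6)] -/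
theorem sum_mul_mul_le_of_rectangles (W : A → B → ℝ) (α : ℝ) (x : A → ℝ) (y : B → ℝ)
    (hx : ∀ a, 0 ≤ x a ∧ x a ≤ 1) (hy : ∀ b, 0 ≤ y b ∧ y b ≤ 1)
    (hrect : ∀ (X : Finset A) (Y : Finset B), (∀ a ∈ X, 0 < x a) → (∀ b ∈ Y, 0 < y b) →
      ∑ a ∈ X, ∑ b ∈ Y, W a b ≤ α) :
    ∑ a, ∑ b, W a b * (x a * y b) ≤ α := by
  classical
  -- round `x`
  set g : A → ℝ := fun a => ∑ b, W a b * y b with hg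
  set X : Finset A := univ.filter fun a => 0 < x a ∧ 0 < g a with hX
  have h1 : ∑ a, ∑ b, W a b * (x a * y b) = ∑ a, x a * g a := by
    refine sum_congr rfl fun a _ => ?_
    rw [hg, Finset.mul_sum]
    exact sum_congr rfl fun b _ => by ring
  have h2 : ∑ a, x a * g a ≤ ∑ a ∈ X, g a := sum_mul_le_sum_filter_pos x g hx
  -- round `y`
  set h : B → ℝ := fun b => ∑ a ∈ X, W a b with hh
  set Y : Finset B := univ.filter fun b => 0 < y b ∧ 0 < h b with hY
  have h3 : ∑ a ∈ X, g a = ∑ b, y b * h b := by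
    simp only [hg, hh, Finset.mul_sum]
    rw [Finset.sum_comm]
    exact sum_congr rfl fun b _ => sum_congr rfl fun a _ => by ring
  have h4 : ∑ b, y b * h b ≤ ∑ b ∈ Y, h b := sum_mul_le_sum_filter_pos y h hy
  have h5 : ∑ b ∈ Y, h b = ∑ a ∈ X, ∑ b ∈ Y, W a b := by
    simp only [hh]
    exact Finset.sum_comm
  have h6 := hrect X Y (fun a ha => (mem_filter.1 ha).2.1) (fun b hb => (mem_filter.1 hb).2.1)
  linarith

variable {I : Type*} [Fintype I]

/-- **Hyperplane separation lower bound** (Fiorini; Rothvoß 2017, Lemma 5), finite form: if a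
nonnegative matrix `S(a,b) = Σ_i U_a(i) T_b(i)` (`U, T ≥ 0`, entries at most `s`) is tested
against a weight matrix `W` whose total weight on every rectangle avoiding the zeros of `S` is
at most `α`, then `⟨W, S⟩ ≤ α · s · |I|` — i.e. the number `|I|` of factors is at least
`⟨W,S⟩ / (‖S‖_∞ α)`. (Each rank-one term `R_i = U(i) T(i)ᵀ` is `‖R_i‖_∞` times a fractional
rectangle supported inside the support of `S`, and `‖R_i‖_∞ ≤ ‖S‖_∞`.)
[cite: Rothvoss2017, Lemma 5 (PDF p. 6)] -/
theorem hyperplane_separation_bound' (U : A → I → ℝ) (T : B → I → ℝ) (hU : ∀ a i, 0 ≤ U a i)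
    (hT : ∀ b i, 0 ≤ T b i) (W : A → B → ℝ) {α s : ℝ} (hs0 : 0 ≤ s)
    (hs : ∀ a b, ∑ i, U a i * T b i ≤ s)
    (hrect : ∀ (X : Finset A) (Y : Finset B), (∀ a ∈ X, ∀ b ∈ Y, ∑ i, U a i * T b i ≠ 0) →
      ∑ a ∈ X, ∑ b ∈ Y, W a b ≤ α) :
    ∑ a, ∑ b, W a b * ∑ i, U a i * T b i ≤ α * s * Fintype.card I := by
  classical
  have hα : 0 ≤ α := by simpa using hrect ∅ ∅ (by simp)
  -- exchange the sums: one fractional rectangle per factor `i`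
  have hswap : ∑ a, ∑ b, W a b * ∑ i, U a i * T b i = ∑ i, ∑ a, ∑ b, W a b * (U a i * T b i) :=
    calc ∑ a, ∑ b, W a b * ∑ i, U a i * T b i = ∑ a, ∑ b, ∑ i, W a b * (U a i * T b i) := by
          simp only [Finset.mul_sum]
      _ = ∑ a, ∑ i, ∑ b, W a b * (U a i * T b i) := sum_congr rfl fun a _ => Finset.sum_comm
      _ = ∑ i, ∑ a, ∑ b, W a b * (U a i * T b i) := Finset.sum_comm
  rw [hswap]
  -- each factor contributes at most `α s`
  have hterm : ∀ i, ∑ a, ∑ b, W a b * (U a i * T b i) ≤ α * s := by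
    intro i
    rcases isEmpty_or_nonempty A with hA | hA
    · simp only [univ_eq_empty, sum_empty]; positivity
    rcases isEmpty_or_nonempty B with hB | hB
    · simp only [univ_eq_empty, sum_empty, sum_const_zero]; positivity
    obtain ⟨a₀, -, ha₀⟩ := exists_max_image univ (fun a => U a i) univ_nonempty
    obtain ⟨b₀, -, hb₀⟩ := exists_max_image univ (fun b => T b i) univ_nonempty
    set mU := U a₀ i with hmU
    set mT := T b₀ i with hmT
    have hmU0 : 0 ≤ mU := hU a₀ i
    have hmT0 : 0 ≤ mT := hT b₀ i
    -- `mU mT ≤ s`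
    have hprod : mU * mT ≤ s := by
      refine le_trans ?_ (hs a₀ b₀)
      rw [hmU, hmT]
      exact Finset.single_le_sum (f := fun i' => U a₀ i' * T b₀ i')
        (fun i' _ => mul_nonneg (hU a₀ i') (hT b₀ i')) (mem_univ i)
    rcases hmU0.lt_or_eq with hUpos | hU0
    swap
    · -- `U · i ≡ 0`
      have hz : ∀ a, U a i = 0 := fun a => le_antisymm (hU0 ▸ ha₀ a (mem_univ a)) (hU a i)
      simp only [hz, zero_mul, mul_zero, sum_const_zero]
      positivity
    rcases hmT0.lt_or_eq with hTpos | hT0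
    swap
    · have hz : ∀ b, T b i = 0 := fun b => le_antisymm (hT0 ▸ hb₀ b (mem_univ b)) (hT b i)
      simp only [hz, mul_zero, sum_const_zero]
      positivity
    -- the normalised fractional rectangle
    set x : A → ℝ := fun a => U a i / mU with hx
    set y : B → ℝ := fun b => T b i / mT with hy
    have hx01 : ∀ a, 0 ≤ x a ∧ x a ≤ 1 := fun a =>
      ⟨div_nonneg (hU a i) hmU0, (div_le_one hUpos).2 (ha₀ a (mem_univ a))⟩
    have hy01 : ∀ b, 0 ≤ y b ∧ y b ≤ 1 := fun b =>
      ⟨div_nonneg (hT b i) hmT0, (div_le_one hTpos).2 (hb₀ b (mem_univ b))⟩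
    have hcube : ∑ a, ∑ b, W a b * (x a * y b) ≤ α := by
      refine sum_mul_mul_le_of_rectangles W α x y hx01 hy01 fun X Y hX hY => hrect X Y ?_
      intro a ha b hb
      have hUa : 0 < U a i := by
        have := hX a ha
        rw [hx] at this
        exact (div_pos_iff_of_pos_right hUpos).1 this
      have hTb : 0 < T b i := by
        have := hY b hb
        rw [hy] at this
        exact (div_pos_iff_of_pos_right hTpos).1 this
      have : U a i * T b i ≤ ∑ i', U a i' * T b i' :=
        Finset.single_le_sum (f := fun i' => U a i' * T b i')
          (fun i' _ => mul_nonneg (hU a i') (hT b i')) (mem_univ i)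
      nlinarith
    have hscale : ∑ a, ∑ b, W a b * (U a i * T b i) =
        (mU * mT) * ∑ a, ∑ b, W a b * (x a * y b) := by
      rw [Finset.mul_sum]
      refine sum_congr rfl fun a _ => ?_
      rw [Finset.mul_sum]
      refine sum_congr rfl fun b _ => ?_
      rw [hx, hy]
      field_simp
    rw [hscale]
    calc mU * mT * ∑ a, ∑ b, W a b * (x a * y b) ≤ mU * mT * α :=
          mul_le_mul_of_nonneg_left hcube (mul_nonneg hmU0 hmT0)
      _ ≤ s * α := mul_le_mul_of_nonneg_right hprod hα
      _ = α * s := mul_comm _ _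
  calc ∑ i, ∑ a, ∑ b, W a b * (U a i * T b i) ≤ ∑ _i : I, α * s := sum_le_sum fun i _ => hterm i
    _ = α * s * Fintype.card I := by
        rw [sum_const, card_univ, nsmul_eq_mul]; ring

end Hyperplane

/-! ### Combination: extended formulations versus a separating hyperplane -/

section Combined

variable {ι : Type} [Fintype ι] {r : ℕ} {A B : Type*} [Fintype A] [Fintype B]

/-- **Extension complexity versus a separating hyperplane** (Yannakakis' factorization
followed by the hyperplane separation bound): if `P` has an extended formulation of size `r`
and carries points `v_b ∈ P` and valid inequalities `c_a · x ≤ d_a` with slacks at most `s`,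
then for every weight matrix `W` whose weight on each rectangle of nonzero-slack entries is at
most `α`, `Σ_{a,b} W(a,b) (d_a - c_a · v_b) ≤ α s (r + 1)`.
[cite: Rothvoss2017, Thm. 4 and Lemma 5 (PDF pp. 5–6)] -/
theorem HasEFOfSize.weight_slack_le {P : Set (ι → ℝ)} (h : HasEFOfSize P r)
    (v : B → ι → ℝ) (hv : ∀ b, v b ∈ P) (c : A → ι → ℝ) (d : A → ℝ)
    (hvalid : ∀ a, ∀ x ∈ P, c a ⬝ᵥ x ≤ d a) (W : A → B → ℝ) {α s : ℝ} (hs0 : 0 ≤ s)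
    (hs : ∀ a b, d a - c a ⬝ᵥ v b ≤ s)
    (hrect : ∀ (X : Finset A) (Y : Finset B), (∀ a ∈ X, ∀ b ∈ Y, d a - c a ⬝ᵥ v b ≠ 0) →
      ∑ a ∈ X, ∑ b ∈ Y, W a b ≤ α) :
    ∑ a, ∑ b, W a b * (d a - c a ⬝ᵥ v b) ≤ α * s * (r + 1) := by
  classical
  obtain ⟨U, T, hU, hT, hfac⟩ := h.exists_nonneg_factorization v hv c d hvalid
  have key := hyperplane_separation_bound' U T hU hT W hs0
    (fun a b => (hfac a b) ▸ hs a b)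
    (fun X Y hXY => hrect X Y fun a ha b hb => (hfac a b) ▸ hXY a ha b hb)
  simp only [Fintype.card_option, Fintype.card_fin, Nat.cast_add, Nat.cast_one] at key
  simpa only [hfac] using key

end Combined

end Literature.Barriers.PneNP
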